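import Mathlib
import Summits.NavierStokesRegularity.NavierStokesRegularity.Theses.ReynoldsMonotone
import Literature.Analysis.FluidPDE.NSWeakStrongUniquenessHolds
import Literature.Analysis.FluidPDE.NSLerayHopfSereginProofs
import Literature.Analysis.FluidPDE.TaoLocalisationProofs
import Literature.Analysis.FluidPDE.LerayHopfProofs
import HarnessLib

/-!
# `ReynoldsMonotone.ClassicalContinuation` — a BKM-class continuation from the same datum extends the
  classical solution (route `ReynoldsMonotone`, item stmt-NavierStokesRegularity-10427, support; known
  composite glue)

**Statement.** A classical Leray–Hopf solution `u` of `NS_ν` on `[0,T)` from a rapidly decaying datum,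
together with a BKM-class classical Leray–Hopf solution `v` from the same datum on a closed slab
`[0,T']`, `T' > T`, extends smoothly past `T`.

PROOF. `v` is bounded on `[0,T']` (Sobolev, `linfty_bound_of_hasBoundedSobolevNormsOn_holds`), hence in
`L^∞_t L^∞_x`, and Prodi–Serrin weak–strong uniqueness at `(q, r) = (∞, ∞)`
(`weak_strong_uniqueness_holds`) gives `u(t) = v(t)` a.e. for `t ∈ (0, T]`; both slices being
continuous, `u(t) = v(t)` on `(0,T)`, and `v 0 = u 0`: `v|[0,T')` is the extension.

HONEST FRAMING: known bookkeeping; nothing here bears on the regularity problem itself.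
-/

noncomputable section

set_option linter.dupNamespace false

namespace Summit.NavierStokesRegularity.NavierStokesRegularity.Theorems

open MeasureTheory Set
open scoped ENNReal NNReal
open Literature.Analysis Literature.Analysis.FluidPDE

/-- **Item stmt-NavierStokesRegularity-10427** (`ReynoldsMonotone.ClassicalContinuation`). [this file;
RobinsonRodrigoSadowski2016 Thm 8.19 (tree: `weak_strong_uniqueness_holds`)] -/
theorem reynoldsMonotone_classicalContinuation_proof :
    Summit.NavierStokesRegularity.NavierStokesRegularity.Theses.ReynoldsMonotone.ClassicalContinuation := by
  unfold Summit.NavierStokesRegularity.NavierStokesRegularity.Theses.ReynoldsMonotone.ClassicalContinuation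
  rintro ν T hν hT u p hcl hLH - ⟨T', hTT', v, q, hclv, hB, hLHv, hv0⟩
  have hT' : 0 < T' := hT.trans hTT'
  -- `v` is bounded on `[0, T']`
  have hB' : HasBoundedSobolevNormsOn (Icc 0 T') v := hB
  obtain ⟨M, hM⟩ := linfty_bound_of_hasBoundedSobolevNormsOn_holds
    (fun t ht => (hclv.contDiff_velocity ht).of_le (by norm_cast)) hB'
  have hmeas : ∀ t ∈ Icc 0 T', AEStronglyMeasurable (v t) volume :=
    fun t ht => (hclv.contDiff_velocity ht).continuous.aestronglyMeasurable
  have hS : MemLqLp ∞ ∞ v (Ioo 0 T) :=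
    memLqLp_top_top_of_bound (fun t ht => hmeas t ⟨ht.1, ht.2.trans hTT'.le⟩)
      (fun t ht x => hM t ⟨ht.1, ht.2.trans hTT'.le⟩ x)
  -- weak–strong uniqueness on `[0, T]`
  have hLHvT : IsLerayHopfOn T ν 0 (u 0) v := hLHv.of_le hTT'.le
  have hr : (3 : ℝ≥0∞) < ⊤ := by simp
  have hqr : (2 : ℝ≥0∞) / ⊤ + 3 / ⊤ ≤ 1 := by simp [ENNReal.div_top]
  have hae : ∀ t ∈ Ioc 0 T, u t =ᵐ[volume] v t := weak_strong_uniqueness_holds hν hT hLHvT hr hqr hS hLH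
  refine ⟨T', hTT', v, q, hclv.mono (fun _ hs => ⟨hs.1, hs.2.le⟩) (uniqueDiffOn_Ico 0 T'), ?_⟩
  intro t ht
  rcases eq_or_lt_of_le ht.1 with h0 | hpos
  · rw [← h0, hv0]
  · have hae' := hae t ⟨hpos, ht.2.le⟩
    have hcu : Continuous (u t) := (hcl.contDiff_velocity ht).continuous
    have hcv : Continuous (v t) := (hclv.contDiff_velocity ⟨ht.1, (ht.2.trans hTT').le⟩).continuous
    exact ((Continuous.ae_eq_iff_eq volume hcu hcv).1 hae').symm

end Summit.NavierStokesRegularity.NavierStokesRegularity.Theorems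

end
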